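import Literature.MathematicalPhysics.QuantumFieldTheory.Balaban1983to89.B8Eq1117KLevel

/-!
# `Balaban1983to89.B8DprimeKLevelLipschitz` — [Balaban1985RegularSpaces] Sect. E p. 97 AT `k` LEVELS: the Lipschitz dependence of the
# solution `D′(λ)` of (1.117) on `λ` over a nested pair `(Ω, Λ)` with region-dependent (tower-local) hypotheses — the step Sect. E uses
# between (1.125) and the onto sentence of p. 97 (r05's abstract `B8Claim97OntoProof.Dprime_lipschitz`, here for the concrete remainder
# `C′_j(u₁, ·)` of (213) [3] and Theorem 4's inductive `u₁`, read on `𝔅_k`)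

statement-level skeleton of published theorems with citation tags; proofs where landed; nothing here is a claim about the Yang–Mills mass gap

T. Bałaban, *Spaces of regular gauge field configurations on a lattice and gauge fixing conditions*, Commun.
Math. Phys. **99** (1985) 75–102 `[Balaban1985RegularSpaces]` ("B8"; printed page = PDF page + 74), pp. 96–97 [PDF 22–23];
[3] = [Balaban1985Averaging], Prop. 10 (213)–(214) p. 50.  PDF held: `paper:balaban1985-cmp99-regular-spaces-gauge-fixing`.  STATUS:
published, refereed.

CITATION HEADER (lean-in-tree rule).  Cell `pub-ymgap` (YM Track A, DAG node N05 = [B8], HUMAN RULING D-0062), seat `pub-ymgap-dag-n05-b`,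
gen 0 («Sect. E at k levels», display split with `pub-ymgap-dag-n04-b`).  WHAT IS REPRODUCED = the Lipschitz sentence behind SKELETON row
**B8.Claim@97** (p. 97: «This solution is an analytic function of λ defined on the set of λ satisfying (1.119) … the mapping (1.113)
transforms the set {λ: …} onto a set containing {λ′: …}»): the tree has it ABSTRACTLY (`B8Claim97OntoProof.Dprime_lipschitz`, r05: «the step
Sect. E does not write out») and concretely at ONE level (`B8Eq1119LambdaSpace.Dprime_concrete_lipschitz`, weight `w = Lᵏ`); here AT `k`
LEVELS for the solutions of `B8Eq1117KLevel.eq1117_existsUnique_kLevel` (this seat), with the difference modulus of `λ₁ − λ₂` read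
tower-locally at the `Ω_j`-scales `L^{−j}`.  INPUTS BY NAME: `B8Eq1117KLevel.{lipschitz_Cnl_tower, dom120_of_119_tower}`,
`B8Eq1122Concrete.cjDiff_sub`.  Kind «kernel-checked proof», theorems only: no `def`, no `… : Prop` fact, no existing module modified.

## THE PRINTED TEXT (p. 97 [PDF 23])

«Applying it [(1.125)] to the expression (1.122) we have |C′(λ − H′X₁) − C′(λ − H′X₂)| ≦ C′₂2B′₀(α₃ + α₄)|X₁ − X₂| … Thus by the
contraction mapping theorem there exists exactly one solution of Eq. (1.117). This solution is an analytic function of λ defined on the set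
of λ satisfying (1.119). We take D′(λ) equal to this solution.»

## WHAT IS CERTIFIED HERE (kernel; axioms `propext` / `Classical.choice` / `Quot.sound`)

Setting of `B8Eq1117KLevel` (tower-local (1.33)/(1.69)/`u₁ = glev_j`/H′-modulus on every `Bʲ(y)`, `y ∈ Λ_j`, `j ≤ k`; `j`-free smallness at
`2α₄`; print's «α₃ + α₄ ≦ 1/(4B′₀C′₂)», `α₃ = 40d·c`, `C′₂ := 2·C2p d`), two site functions `λ₁, λ₂` in the half-size set (1.119) on every
tower, whose difference has modulus `m ≥ 0` there (`‖(λ₁ − λ₂)(x)‖ ≤ m`, `‖R(U₀(b))(λ₁ − λ₂)(b₊) − (λ₁ − λ₂)(b₋)‖ ≤ mL^{−j}`), and `X₁, X₂` in the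
ball `‖Xᵢ‖ ≤ α₄/(2B′₀)` solving (1.117) on `𝔅_k` for `λ₁`, `λ₂` and vanishing off `𝔅_k` (the `D′(λᵢ)` of `B8Eq1117KLevel`).
* `Dprime_diff_le_kLevel` — the key inequality `‖X₁ − X₂‖ ≤ c·m + c·B′₀‖X₁ − X₂‖`, `c = 2C2p(α₃ + 2α₄)` (r05's proof: `X₁ − X₂ =
  C′(λ₁ − H′X₁) − C′(λ₂ − H′X₂)` pointwise on `𝔅_k`; the Lipschitz sentence at each `(j, y)` — `lipschitz_Cnl_tower` at `2α₄`, modulus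
  `m + B′₀‖X₁ − X₂‖`); `smallness_prod` — print's «α₃ + α₄ ≦ 1/(4B′₀C′₂)» in product form;
* **`Dprime_lipschitz_kLevel`** — `‖X₁ − X₂‖ ≤ 4·C2p·(α₃ + 2α₄)·m` under print's smallness (`cB′₀ ≤ ½`);
* **`HDprime_modulus_third_kLevel`** — under the HALVED smallness «α₃ + α₄ ≦ 1/(8B′₀C′₂)» (r05's `B8Claim97OntoProof`: «for α₃, α₄
  sufficiently small»), `B′₀‖X₁ − X₂‖ ≤ m/3`: `λ ↦ H′D′(λ)` contracts the k-level modulus by ⅓ — the input of the p. 97 onto sentence.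

## HONEST SCOPE — what is NOT claimed

(i) The constant `4·C2p·(α₃ + 2α₄)` is this lineage's (p05's `C′₂ := 2·C2p`, the `2α₄` instance; r05's abstract `c/(1 − cB′₀)`), merely
sufficient.  (ii) Analyticity of `D′` in `λ` («analytic function of λ») is NOT proved here (the concrete `C′`'s analyticity, (1.123)/(1.124)
tower-local, is dag-n04-b's file 6; the abstract step is `B8Eq1117Analytic`).  (iii) The onto sentence of p. 97 at `k` levels needs a
`k`-level λ-space (r05's `B8Eq1119LambdaSpace` is one-level) — not here.  Nothing here is progress on the summit.
-/

noncomputable section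

open NormedSpace Finset

namespace Literature.MathematicalPhysics.QuantumFieldTheory.Balaban1983to89.B8DprimeKLevelLipschitz

open B7Prop1Explicit B7Prop2Explicit B7Prop3Flat B7Prop1Local B7Eq167Flat B7Eq167General
open B7Eq170Flat (cj cj_apply)
open B7Prop10General (C6 C4G)
open B7Prop10Flat (one_le_C5 C4'_nonneg C5'_nonneg)
open B7Prop9Flat (C5')
open B7Eq214General (Cgen)
open B8Ineq130 (tlo thi)
open B7Eq84Concrete (glev)
open B8Eq1123Concrete (Cnl)
open B8Ineq125Concrete (C2p C2p_nonneg)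
open B8Eq1122Concrete (cjDiff_sub)
open B8Eq1117Concrete (XSpace)
open B8Eq1117KLevel (lipschitz_Cnl_tower dom120_of_119_tower)

-- `Site` alone could resolve to the torus sites of `Setup.lean`; re-export the `ℤ^d` sites of `B7Prop1Explicit`.
export B7Prop1Explicit (Site)

variable {d : ℕ}

variable {𝔸 : Type*} [NormedRing 𝔸] [NormOneClass 𝔸] [NormedAlgebra ℂ 𝔸] [CompleteSpace 𝔸]

/-- **THE KEY INEQUALITY FOR `D′(λ₁) − D′(λ₂)` AT `k` LEVELS** (the step behind p. 97's «analytic function of λ» / onto sentence,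
r05's `B8Claim97OntoProof.Dprime_lipschitz`, here for the concrete `C′_j(u₁, ·)` on `𝔅_k`, with no smallness beyond (214)'s): in the
setting of `B8Eq1117KLevel.eq1117_existsUnique_kLevel`, for `λ₁, λ₂` in the half-size set (1.119) on every tower with difference modulus
`m` there, and `X₁, X₂` in the ball solving (1.117) on `𝔅_k` for `λ₁, λ₂` and vanishing off `𝔅_k`:
`‖X₁ − X₂‖ ≤ c·m + c·B′₀·‖X₁ − X₂‖`, `c = 2C2p(α₃ + 2α₄)` (`α₃ = 40d·c`) — `X₁ − X₂ = C′(λ₁ − H′X₁) − C′(λ₂ − H′X₂)` on `𝔅_k` and the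
Lipschitz sentence at each point with modulus `m + B′₀‖X₁ − X₂‖`.
[cite: Balaban1985RegularSpaces, p.97 (after (1.125)), (1.117)–(1.122) p.96, (1.125) p.97] -/
theorem Dprime_diff_le_kLevel {L : ℕ} (hL : 2 ≤ L) (hL1 : 1 ≤ L) {G : Subgroup 𝔸ˣ} (hG : AvgClosed d L G)
    {U₀ : Site d → Fin d → 𝔸ˣ} (hU₀ : ∀ x κ, U₀ x κ ∈ G) {k : ℕ} (Λ : ℕ → Set (Site d))
    (H' : XSpace d k 𝔸 →ₗ[ℂ] (Site d → 𝔸)) (lam₁ lam₂ : Site d → 𝔸) {B : Site d → Fin d → 𝔸} {u₁ : Site d → 𝔸ˣ}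
    {α₀ α₄ c B₀' m : ℝ}
    (hα : 0 < α₀) (hα3 : C0 d * α₀ ≤ 1 / 3) (hα4 : 4 * α₀ ≤ c2' d L) (hc : 0 ≤ c) (hα₄ : 0 < α₄) (hB : 0 < B₀') (hm : 0 ≤ m)
    (h33 : ∀ j, j ≤ k → ∀ y ∈ Λ j, pdevOn (tlo L y j) (thi L y j) U₀ < α₀ * (((L : ℝ) ^ j)⁻¹) ^ 2)
    (h69 : ∀ j, j ≤ k → ∀ y ∈ Λ j, ∀ (x : Site d) (κ : Fin d), InBox (tlo L y j) (thi L y j) x →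
      InBox (tlo L y j) (thi L y j) (x + e κ) → ‖B x κ‖ ≤ c * ((L : ℝ) ^ j)⁻¹)
    (hu₁ : ∀ j, j ≤ k → ∀ y ∈ Λ j, ∀ x : Site d, tlo L y j ≤ x → x ≤ thi L y j → u₁ x = glev L hL1 U₀ (expCfg B) j 0 x)
    (h₁b : ∀ j, j ≤ k → ∀ y ∈ Λ j, ∀ x : Site d, InBox (tlo L y j) (thi L y j) x → ‖lam₁ x‖ < α₄ / 2)
    (h₁a : ∀ j, j ≤ k → ∀ y ∈ Λ j, ∀ (x : Site d) (κ : Fin d), InBox (tlo L y j) (thi L y j) x →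
      InBox (tlo L y j) (thi L y j) (x + e κ) → ‖cj (U₀ x κ) (lam₁ (x + e κ)) - lam₁ x‖ < α₄ / 2 * ((L : ℝ) ^ j)⁻¹)
    (h₂b : ∀ j, j ≤ k → ∀ y ∈ Λ j, ∀ x : Site d, InBox (tlo L y j) (thi L y j) x → ‖lam₂ x‖ < α₄ / 2)
    (h₂a : ∀ j, j ≤ k → ∀ y ∈ Λ j, ∀ (x : Site d) (κ : Fin d), InBox (tlo L y j) (thi L y j) x →
      InBox (tlo L y j) (thi L y j) (x + e κ) → ‖cj (U₀ x κ) (lam₂ (x + e κ)) - lam₂ x‖ < α₄ / 2 * ((L : ℝ) ^ j)⁻¹)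
    (hmb : ∀ j, j ≤ k → ∀ y ∈ Λ j, ∀ x : Site d, InBox (tlo L y j) (thi L y j) x → ‖(lam₁ - lam₂) x‖ ≤ m)
    (hma : ∀ j, j ≤ k → ∀ y ∈ Λ j, ∀ (x : Site d) (κ : Fin d), InBox (tlo L y j) (thi L y j) x →
      InBox (tlo L y j) (thi L y j) (x + e κ) → ‖cj (U₀ x κ) ((lam₁ - lam₂) (x + e κ)) - (lam₁ - lam₂) x‖ ≤ m * ((L : ℝ) ^ j)⁻¹)
    (hH0 : ∀ (X : XSpace d k 𝔸) (x : Site d), ‖H' X x‖ ≤ B₀' * ‖X‖)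
    (hH1 : ∀ j, j ≤ k → ∀ y ∈ Λ j, ∀ (X : XSpace d k 𝔸) (x : Site d) (κ : Fin d), InBox (tlo L y j) (thi L y j) x →
      InBox (tlo L y j) (thi L y j) (x + e κ) → ‖cj (U₀ x κ) (H' X (x + e κ)) - H' X x‖ ≤ B₀' * ‖X‖ * ((L : ℝ) ^ j)⁻¹)
    (hsmall : Real.exp (4 * (800 * ((d : ℝ) + 1) ^ 2 * ((d : ℝ) + 4)) * α₀) * (1 + 8 * (131072 * ((d : ℝ) + 1) ^ 2) * c) ≤ 2)
    (hc₃ : 2 * c ≤ c3 d L) (hs : 128 * (d : ℝ) * c ≤ 1) (hα₃' : 40 * d * c ≤ 1 / 200)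
    (hs₁ : 200 * C6 d * (2 * α₄) ≤ 1) (hs₂ : 12000 * ((d : ℝ) + 1) * L * (2 * α₄) ≤ 1)
    (hs₃ : C4G d L * (α₀ + 40 * d * c + 4 * (2 * α₄)) ≤ 1)
    (hs₄ : 1024 * ((d : ℝ) + 1) * ((d : ℝ) + 4) * L ^ 2 * α₀ ≤ 1) (hs₅ : 32 * ((d : ℝ) + 1) ^ 2 * C6 d * L ^ 2 * α₀ ≤ 1)
    (hs₆ : 16 * d * C5' d * C6 d * (L : ℝ) ^ 2 * α₀ ≤ 1) (hs₇ : 8 * d * C6 d * L * α₀ ≤ 1)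
    {X₁ X₂ : XSpace d k 𝔸} (hX₁ : ‖X₁‖ ≤ α₄ / (2 * B₀')) (hX₂ : ‖X₂‖ ≤ α₄ / (2 * B₀'))
    (hzero₁ : ∀ (j : ℕ) (hj : j ≤ k) (y : Site d), y ∉ Λ j → X₁ (⟨j, Nat.lt_succ_of_le hj⟩, y) = 0)
    (hfix₁ : ∀ (j : ℕ) (hj : j ≤ k) (y : Site d), y ∈ Λ j → Cnl L U₀ u₁ j (lam₁ - H' X₁) y = X₁ (⟨j, Nat.lt_succ_of_le hj⟩, y))
    (hzero₂ : ∀ (j : ℕ) (hj : j ≤ k) (y : Site d), y ∉ Λ j → X₂ (⟨j, Nat.lt_succ_of_le hj⟩, y) = 0)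
    (hfix₂ : ∀ (j : ℕ) (hj : j ≤ k) (y : Site d), y ∈ Λ j → Cnl L U₀ u₁ j (lam₂ - H' X₂) y = X₂ (⟨j, Nat.lt_succ_of_le hj⟩, y)) :
    ‖X₁ - X₂‖ ≤ 2 * C2p d * (40 * d * c + 2 * α₄) * m + (2 * C2p d * (40 * d * c + 2 * α₄) * B₀') * ‖X₁ - X₂‖ := by
  have hC2 : 0 ≤ C2p d := C2p_nonneg d
  have hα₃ : (0 : ℝ) ≤ 40 * d * c := by positivity
  -- the modulus of `(λ₁ − H′X₁) − (λ₂ − H′X₂) = (λ₁ − λ₂) − H′(X₁ − X₂)` on the towers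
  set m' : ℝ := m + B₀' * ‖X₁ - X₂‖ with hm'
  have hm'0 : 0 ≤ m' := by positivity
  have hdiff : lam₁ - H' X₁ - (lam₂ - H' X₂) = (lam₁ - lam₂) - H' (X₁ - X₂) := by rw [map_sub]; abel
  -- the pointwise estimate on `𝔅_k`
  have hkey : ‖X₁ - X₂‖ ≤ C2p d * (2 * m') * (40 * d * c + 2 * α₄) := by
    refine (BoundedContinuousFunction.norm_le (by positivity)).2 fun p => ?_
    have hp : ((⟨(p.1 : ℕ), Nat.lt_succ_of_le (Nat.le_of_lt_succ p.1.isLt)⟩ : Fin (k + 1)), p.2) = p :=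
      Prod.ext (Fin.ext rfl) rfl
    have hj := Nat.le_of_lt_succ p.1.isLt
    rw [BoundedContinuousFunction.coe_sub, Pi.sub_apply]
    by_cases hy : p.2 ∈ Λ p.1
    · have e₁ := hfix₁ p.1 hj p.2 hy
      have e₂ := hfix₂ p.1 hj p.2 hy
      rw [hp] at e₁ e₂
      rw [← e₁, ← e₂]
      have h2 : 2 * α₄ / 2 = α₄ := by ring
      obtain ⟨hXa, hXb⟩ := dom120_of_119_tower H' hB (by positivity) hH0 (hH1 p.1 hj p.2 hy) (h₁a p.1 hj p.2 hy)
        (h₁b p.1 hj p.2 hy) hX₁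
      obtain ⟨hYa, hYb⟩ := dom120_of_119_tower H' hB (by positivity) hH0 (hH1 p.1 hj p.2 hy) (h₂a p.1 hj p.2 hy)
        (h₂b p.1 hj p.2 hy) hX₂
      have hmb' : ∀ x : Site d, InBox (tlo L p.2 p.1) (thi L p.2 p.1) x → ‖(lam₁ - H' X₁ - (lam₂ - H' X₂)) x‖ ≤ m' := by
        intro x hx
        rw [hdiff, Pi.sub_apply]
        calc ‖(lam₁ - lam₂) x - H' (X₁ - X₂) x‖ ≤ ‖(lam₁ - lam₂) x‖ + ‖H' (X₁ - X₂) x‖ := norm_sub_le _ _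
          _ ≤ m + B₀' * ‖X₁ - X₂‖ := add_le_add (hmb p.1 hj p.2 hy x hx) (hH0 (X₁ - X₂) x)
      have hma' : ∀ (x : Site d) (κ : Fin d), InBox (tlo L p.2 p.1) (thi L p.2 p.1) x →
          InBox (tlo L p.2 p.1) (thi L p.2 p.1) (x + e κ) →
          ‖cj (U₀ x κ) ((lam₁ - H' X₁ - (lam₂ - H' X₂)) (x + e κ)) - (lam₁ - H' X₁ - (lam₂ - H' X₂)) x‖ ≤
            m' * ((L : ℝ) ^ (p.1 : ℕ))⁻¹ := by
        intro x κ hx hxe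
        rw [hdiff, cjDiff_sub]
        calc ‖cj (U₀ x κ) ((lam₁ - lam₂) (x + e κ)) - (lam₁ - lam₂) x -
              (cj (U₀ x κ) (H' (X₁ - X₂) (x + e κ)) - H' (X₁ - X₂) x)‖
            ≤ ‖cj (U₀ x κ) ((lam₁ - lam₂) (x + e κ)) - (lam₁ - lam₂) x‖ +
                ‖cj (U₀ x κ) (H' (X₁ - X₂) (x + e κ)) - H' (X₁ - X₂) x‖ := norm_sub_le _ _
          _ ≤ m * ((L : ℝ) ^ (p.1 : ℕ))⁻¹ + B₀' * ‖X₁ - X₂‖ * ((L : ℝ) ^ (p.1 : ℕ))⁻¹ :=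
              add_le_add (hma p.1 hj p.2 hy x κ hx hxe) (hH1 p.1 hj p.2 hy (X₁ - X₂) x κ hx hxe)
          _ = m' * ((L : ℝ) ^ (p.1 : ℕ))⁻¹ := by rw [hm']; ring
      exact lipschitz_Cnl_tower hL hG hU₀ hα hα3 hα4 (h33 p.1 hj p.2 hy) hc (h69 p.1 hj p.2 hy) hsmall hc₃ hs hL1
        (hu₁ p.1 hj p.2 hy) (by positivity : 0 < 2 * α₄) hm'0
        (fun x hx => by rw [h2]; exact hXb x hx) (fun x κ hx hxe => by rw [h2]; exact hXa x κ hx hxe)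
        (fun x hx => by rw [h2]; exact hYb x hx) (fun x κ hx hxe => by rw [h2]; exact hYa x κ hx hxe)
        hmb' hma' hα₃' hs₁ hs₂ hs₃ hs₄ hs₅ hs₆ hs₇
    · have e₁ := hzero₁ p.1 hj p.2 hy
      have e₂ := hzero₂ p.1 hj p.2 hy
      rw [hp] at e₁ e₂
      rw [e₁, e₂, sub_self, norm_zero]
      positivity
  -- regroup
  have e : C2p d * (2 * m') * (40 * d * c + 2 * α₄) =
      2 * C2p d * (40 * d * c + 2 * α₄) * m + (2 * C2p d * (40 * d * c + 2 * α₄) * B₀') * ‖X₁ - X₂‖ := by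
    rw [hm']; ring
  rw [← e]; exact hkey

/-- Print's smallness «α₃ + α₄ ≦ 1/(4B′₀C′₂)» (`C′₂ := 2·C2p`, `α₃ = 40d·c`) in product form: `C2p·(α₃ + α₄)·B′₀ ≤ 1/8`, hence
`2C2p(α₃ + 2α₄)B′₀ ≤ ½`. [cite: Balaban1985RegularSpaces, p.97 (contraction condition)] -/
theorem smallness_prod {α₄ c B₀' : ℝ} (hc : 0 ≤ (d : ℝ) * c) (hB : 0 < B₀') (hC : 0 < C2p d)
    (hsm : 40 * d * c + α₄ ≤ 1 / (4 * B₀' * (2 * C2p d))) :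
    C2p d * (40 * d * c + α₄) * B₀' ≤ 1 / 8 ∧ 2 * C2p d * (40 * d * c + 2 * α₄) * B₀' ≤ 1 / 2 := by
  have h1 : (40 * d * c + α₄) * (4 * B₀' * (2 * C2p d)) ≤ 1 := by
    have := mul_le_mul_of_nonneg_right hsm (by positivity : (0 : ℝ) ≤ 4 * B₀' * (2 * C2p d))
    rwa [one_div, inv_mul_cancel₀ (by positivity)] at this
  have hprod : C2p d * (40 * d * c + α₄) * B₀' ≤ 1 / 8 := by
    have e : C2p d * (40 * d * c + α₄) * B₀' = (40 * d * c + α₄) * (4 * B₀' * (2 * C2p d)) / 8 := by ring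
    rw [e]
    linarith only [h1]
  refine ⟨hprod, ?_⟩
  have e : 2 * C2p d * (40 * d * c + 2 * α₄) * B₀' = 4 * (C2p d * (40 * d * c + α₄) * B₀') - 2 * C2p d * B₀' * (40 * (d * c)) := by
    ring
  have h0 : 0 ≤ 2 * C2p d * B₀' * (40 * (d * c)) := by positivity
  rw [e]
  linarith only [hprod, h0]

/-- **`D′` IS LIPSCHITZ IN `λ` AT `k` LEVELS, under print's smallness «α₃ + α₄ ≦ 1/(4B′₀C′₂)»**: `‖X₁ − X₂‖ ≤ 4·C2p·(α₃ + 2α₄)·m`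
(from `Dprime_diff_le_kLevel` and `2C2p(α₃ + 2α₄)B′₀ ≤ ½`). [cite: Balaban1985RegularSpaces, p.97 (after (1.125)), (1.117)–(1.122) p.96] -/
theorem Dprime_lipschitz_kLevel {L : ℕ} (hL : 2 ≤ L) (hL1 : 1 ≤ L) {G : Subgroup 𝔸ˣ} (hG : AvgClosed d L G)
    {U₀ : Site d → Fin d → 𝔸ˣ} (hU₀ : ∀ x κ, U₀ x κ ∈ G) {k : ℕ} (Λ : ℕ → Set (Site d))
    (H' : XSpace d k 𝔸 →ₗ[ℂ] (Site d → 𝔸)) (lam₁ lam₂ : Site d → 𝔸) {B : Site d → Fin d → 𝔸} {u₁ : Site d → 𝔸ˣ}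
    {α₀ α₄ c B₀' m : ℝ}
    (hα : 0 < α₀) (hα3 : C0 d * α₀ ≤ 1 / 3) (hα4 : 4 * α₀ ≤ c2' d L) (hc : 0 ≤ c) (hα₄ : 0 < α₄) (hB : 0 < B₀') (hm : 0 ≤ m)
    (h33 : ∀ j, j ≤ k → ∀ y ∈ Λ j, pdevOn (tlo L y j) (thi L y j) U₀ < α₀ * (((L : ℝ) ^ j)⁻¹) ^ 2)
    (h69 : ∀ j, j ≤ k → ∀ y ∈ Λ j, ∀ (x : Site d) (κ : Fin d), InBox (tlo L y j) (thi L y j) x →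
      InBox (tlo L y j) (thi L y j) (x + e κ) → ‖B x κ‖ ≤ c * ((L : ℝ) ^ j)⁻¹)
    (hu₁ : ∀ j, j ≤ k → ∀ y ∈ Λ j, ∀ x : Site d, tlo L y j ≤ x → x ≤ thi L y j → u₁ x = glev L hL1 U₀ (expCfg B) j 0 x)
    (h₁b : ∀ j, j ≤ k → ∀ y ∈ Λ j, ∀ x : Site d, InBox (tlo L y j) (thi L y j) x → ‖lam₁ x‖ < α₄ / 2)
    (h₁a : ∀ j, j ≤ k → ∀ y ∈ Λ j, ∀ (x : Site d) (κ : Fin d), InBox (tlo L y j) (thi L y j) x →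
      InBox (tlo L y j) (thi L y j) (x + e κ) → ‖cj (U₀ x κ) (lam₁ (x + e κ)) - lam₁ x‖ < α₄ / 2 * ((L : ℝ) ^ j)⁻¹)
    (h₂b : ∀ j, j ≤ k → ∀ y ∈ Λ j, ∀ x : Site d, InBox (tlo L y j) (thi L y j) x → ‖lam₂ x‖ < α₄ / 2)
    (h₂a : ∀ j, j ≤ k → ∀ y ∈ Λ j, ∀ (x : Site d) (κ : Fin d), InBox (tlo L y j) (thi L y j) x →
      InBox (tlo L y j) (thi L y j) (x + e κ) → ‖cj (U₀ x κ) (lam₂ (x + e κ)) - lam₂ x‖ < α₄ / 2 * ((L : ℝ) ^ j)⁻¹)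
    (hmb : ∀ j, j ≤ k → ∀ y ∈ Λ j, ∀ x : Site d, InBox (tlo L y j) (thi L y j) x → ‖(lam₁ - lam₂) x‖ ≤ m)
    (hma : ∀ j, j ≤ k → ∀ y ∈ Λ j, ∀ (x : Site d) (κ : Fin d), InBox (tlo L y j) (thi L y j) x →
      InBox (tlo L y j) (thi L y j) (x + e κ) → ‖cj (U₀ x κ) ((lam₁ - lam₂) (x + e κ)) - (lam₁ - lam₂) x‖ ≤ m * ((L : ℝ) ^ j)⁻¹)
    (hH0 : ∀ (X : XSpace d k 𝔸) (x : Site d), ‖H' X x‖ ≤ B₀' * ‖X‖)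
    (hH1 : ∀ j, j ≤ k → ∀ y ∈ Λ j, ∀ (X : XSpace d k 𝔸) (x : Site d) (κ : Fin d), InBox (tlo L y j) (thi L y j) x →
      InBox (tlo L y j) (thi L y j) (x + e κ) → ‖cj (U₀ x κ) (H' X (x + e κ)) - H' X x‖ ≤ B₀' * ‖X‖ * ((L : ℝ) ^ j)⁻¹)
    (hsmall : Real.exp (4 * (800 * ((d : ℝ) + 1) ^ 2 * ((d : ℝ) + 4)) * α₀) * (1 + 8 * (131072 * ((d : ℝ) + 1) ^ 2) * c) ≤ 2)
    (hc₃ : 2 * c ≤ c3 d L) (hs : 128 * (d : ℝ) * c ≤ 1) (hα₃' : 40 * d * c ≤ 1 / 200)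
    (hs₁ : 200 * C6 d * (2 * α₄) ≤ 1) (hs₂ : 12000 * ((d : ℝ) + 1) * L * (2 * α₄) ≤ 1)
    (hs₃ : C4G d L * (α₀ + 40 * d * c + 4 * (2 * α₄)) ≤ 1)
    (hs₄ : 1024 * ((d : ℝ) + 1) * ((d : ℝ) + 4) * L ^ 2 * α₀ ≤ 1) (hs₅ : 32 * ((d : ℝ) + 1) ^ 2 * C6 d * L ^ 2 * α₀ ≤ 1)
    (hs₆ : 16 * d * C5' d * C6 d * (L : ℝ) ^ 2 * α₀ ≤ 1) (hs₇ : 8 * d * C6 d * L * α₀ ≤ 1)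
    (hsm : 40 * d * c + α₄ ≤ 1 / (4 * B₀' * (2 * C2p d)))
    {X₁ X₂ : XSpace d k 𝔸} (hX₁ : ‖X₁‖ ≤ α₄ / (2 * B₀')) (hX₂ : ‖X₂‖ ≤ α₄ / (2 * B₀'))
    (hzero₁ : ∀ (j : ℕ) (hj : j ≤ k) (y : Site d), y ∉ Λ j → X₁ (⟨j, Nat.lt_succ_of_le hj⟩, y) = 0)
    (hfix₁ : ∀ (j : ℕ) (hj : j ≤ k) (y : Site d), y ∈ Λ j → Cnl L U₀ u₁ j (lam₁ - H' X₁) y = X₁ (⟨j, Nat.lt_succ_of_le hj⟩, y))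
    (hzero₂ : ∀ (j : ℕ) (hj : j ≤ k) (y : Site d), y ∉ Λ j → X₂ (⟨j, Nat.lt_succ_of_le hj⟩, y) = 0)
    (hfix₂ : ∀ (j : ℕ) (hj : j ≤ k) (y : Site d), y ∈ Λ j → Cnl L U₀ u₁ j (lam₂ - H' X₂) y = X₂ (⟨j, Nat.lt_succ_of_le hj⟩, y)) :
    ‖X₁ - X₂‖ ≤ 4 * C2p d * (40 * d * c + 2 * α₄) * m := by
  have hC2pos : 0 < C2p d := by
    have hC6 : (2 : ℝ) ≤ C6 d := by unfold C6; linarith [one_le_C5 (d := d)]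
    unfold C2p Cgen; positivity
  have hkey := Dprime_diff_le_kLevel hL hL1 hG hU₀ Λ H' lam₁ lam₂ hα hα3 hα4 hc hα₄ hB hm h33 h69 hu₁ h₁b h₁a h₂b h₂a hmb hma
    hH0 hH1 hsmall hc₃ hs hα₃' hs₁ hs₂ hs₃ hs₄ hs₅ hs₆ hs₇ hX₁ hX₂ hzero₁ hfix₁ hzero₂ hfix₂
  have hhalf := (smallness_prod (d := d) (by positivity) hB hC2pos hsm).2
  have hXY := norm_nonneg (X₁ - X₂)
  have hk3 : (2 * C2p d * (40 * d * c + 2 * α₄) * B₀') * ‖X₁ - X₂‖ ≤ 1 / 2 * ‖X₁ - X₂‖ :=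
    mul_le_mul_of_nonneg_right hhalf hXY
  linarith only [hkey, hk3]

/-- **`λ ↦ H′D′(λ)` IS A ⅓-CONTRACTION FOR THE k-LEVEL MODULUS under the HALVED smallness «α₃ + α₄ ≦ 1/(8B′₀C′₂)»** (the input of the
p. 97 onto sentence, r05's `B8Claim97OntoProof.HDprime_lipschitz_half`, here at `k` levels): `B′₀‖X₁ − X₂‖ ≤ m/3`, so both tower moduli of
`H′(X₁ − X₂)` (sites: `≤ B′₀‖X₁ − X₂‖`; bonds: `≤ B′₀‖X₁ − X₂‖L^{−j}`) are at most a third of those of `λ₁ − λ₂`.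
[cite: Balaban1985RegularSpaces, p.97 (onto sentence, «for α₃, α₄ sufficiently small»), (1.92) p.91] -/
theorem HDprime_modulus_third_kLevel {L : ℕ} (hL : 2 ≤ L) (hL1 : 1 ≤ L) {G : Subgroup 𝔸ˣ} (hG : AvgClosed d L G)
    {U₀ : Site d → Fin d → 𝔸ˣ} (hU₀ : ∀ x κ, U₀ x κ ∈ G) {k : ℕ} (Λ : ℕ → Set (Site d))
    (H' : XSpace d k 𝔸 →ₗ[ℂ] (Site d → 𝔸)) (lam₁ lam₂ : Site d → 𝔸) {B : Site d → Fin d → 𝔸} {u₁ : Site d → 𝔸ˣ}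
    {α₀ α₄ c B₀' m : ℝ}
    (hα : 0 < α₀) (hα3 : C0 d * α₀ ≤ 1 / 3) (hα4 : 4 * α₀ ≤ c2' d L) (hc : 0 ≤ c) (hα₄ : 0 < α₄) (hB : 0 < B₀') (hm : 0 ≤ m)
    (h33 : ∀ j, j ≤ k → ∀ y ∈ Λ j, pdevOn (tlo L y j) (thi L y j) U₀ < α₀ * (((L : ℝ) ^ j)⁻¹) ^ 2)
    (h69 : ∀ j, j ≤ k → ∀ y ∈ Λ j, ∀ (x : Site d) (κ : Fin d), InBox (tlo L y j) (thi L y j) x →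
      InBox (tlo L y j) (thi L y j) (x + e κ) → ‖B x κ‖ ≤ c * ((L : ℝ) ^ j)⁻¹)
    (hu₁ : ∀ j, j ≤ k → ∀ y ∈ Λ j, ∀ x : Site d, tlo L y j ≤ x → x ≤ thi L y j → u₁ x = glev L hL1 U₀ (expCfg B) j 0 x)
    (h₁b : ∀ j, j ≤ k → ∀ y ∈ Λ j, ∀ x : Site d, InBox (tlo L y j) (thi L y j) x → ‖lam₁ x‖ < α₄ / 2)
    (h₁a : ∀ j, j ≤ k → ∀ y ∈ Λ j, ∀ (x : Site d) (κ : Fin d), InBox (tlo L y j) (thi L y j) x →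
      InBox (tlo L y j) (thi L y j) (x + e κ) → ‖cj (U₀ x κ) (lam₁ (x + e κ)) - lam₁ x‖ < α₄ / 2 * ((L : ℝ) ^ j)⁻¹)
    (h₂b : ∀ j, j ≤ k → ∀ y ∈ Λ j, ∀ x : Site d, InBox (tlo L y j) (thi L y j) x → ‖lam₂ x‖ < α₄ / 2)
    (h₂a : ∀ j, j ≤ k → ∀ y ∈ Λ j, ∀ (x : Site d) (κ : Fin d), InBox (tlo L y j) (thi L y j) x →
      InBox (tlo L y j) (thi L y j) (x + e κ) → ‖cj (U₀ x κ) (lam₂ (x + e κ)) - lam₂ x‖ < α₄ / 2 * ((L : ℝ) ^ j)⁻¹)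
    (hmb : ∀ j, j ≤ k → ∀ y ∈ Λ j, ∀ x : Site d, InBox (tlo L y j) (thi L y j) x → ‖(lam₁ - lam₂) x‖ ≤ m)
    (hma : ∀ j, j ≤ k → ∀ y ∈ Λ j, ∀ (x : Site d) (κ : Fin d), InBox (tlo L y j) (thi L y j) x →
      InBox (tlo L y j) (thi L y j) (x + e κ) → ‖cj (U₀ x κ) ((lam₁ - lam₂) (x + e κ)) - (lam₁ - lam₂) x‖ ≤ m * ((L : ℝ) ^ j)⁻¹)
    (hH0 : ∀ (X : XSpace d k 𝔸) (x : Site d), ‖H' X x‖ ≤ B₀' * ‖X‖)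
    (hH1 : ∀ j, j ≤ k → ∀ y ∈ Λ j, ∀ (X : XSpace d k 𝔸) (x : Site d) (κ : Fin d), InBox (tlo L y j) (thi L y j) x →
      InBox (tlo L y j) (thi L y j) (x + e κ) → ‖cj (U₀ x κ) (H' X (x + e κ)) - H' X x‖ ≤ B₀' * ‖X‖ * ((L : ℝ) ^ j)⁻¹)
    (hsmall : Real.exp (4 * (800 * ((d : ℝ) + 1) ^ 2 * ((d : ℝ) + 4)) * α₀) * (1 + 8 * (131072 * ((d : ℝ) + 1) ^ 2) * c) ≤ 2)
    (hc₃ : 2 * c ≤ c3 d L) (hs : 128 * (d : ℝ) * c ≤ 1) (hα₃' : 40 * d * c ≤ 1 / 200)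
    (hs₁ : 200 * C6 d * (2 * α₄) ≤ 1) (hs₂ : 12000 * ((d : ℝ) + 1) * L * (2 * α₄) ≤ 1)
    (hs₃ : C4G d L * (α₀ + 40 * d * c + 4 * (2 * α₄)) ≤ 1)
    (hs₄ : 1024 * ((d : ℝ) + 1) * ((d : ℝ) + 4) * L ^ 2 * α₀ ≤ 1) (hs₅ : 32 * ((d : ℝ) + 1) ^ 2 * C6 d * L ^ 2 * α₀ ≤ 1)
    (hs₆ : 16 * d * C5' d * C6 d * (L : ℝ) ^ 2 * α₀ ≤ 1) (hs₇ : 8 * d * C6 d * L * α₀ ≤ 1)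
    (hsm8 : 40 * d * c + α₄ ≤ 1 / (8 * B₀' * (2 * C2p d)))
    {X₁ X₂ : XSpace d k 𝔸} (hX₁ : ‖X₁‖ ≤ α₄ / (2 * B₀')) (hX₂ : ‖X₂‖ ≤ α₄ / (2 * B₀'))
    (hzero₁ : ∀ (j : ℕ) (hj : j ≤ k) (y : Site d), y ∉ Λ j → X₁ (⟨j, Nat.lt_succ_of_le hj⟩, y) = 0)
    (hfix₁ : ∀ (j : ℕ) (hj : j ≤ k) (y : Site d), y ∈ Λ j → Cnl L U₀ u₁ j (lam₁ - H' X₁) y = X₁ (⟨j, Nat.lt_succ_of_le hj⟩, y))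
    (hzero₂ : ∀ (j : ℕ) (hj : j ≤ k) (y : Site d), y ∉ Λ j → X₂ (⟨j, Nat.lt_succ_of_le hj⟩, y) = 0)
    (hfix₂ : ∀ (j : ℕ) (hj : j ≤ k) (y : Site d), y ∈ Λ j → Cnl L U₀ u₁ j (lam₂ - H' X₂) y = X₂ (⟨j, Nat.lt_succ_of_le hj⟩, y)) :
    B₀' * ‖X₁ - X₂‖ ≤ m / 3 := by
  have hC2pos : 0 < C2p d := by
    have hC6 : (2 : ℝ) ≤ C6 d := by unfold C6; linarith [one_le_C5 (d := d)]
    unfold C2p Cgen; positivity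
  have hkey := Dprime_diff_le_kLevel hL hL1 hG hU₀ Λ H' lam₁ lam₂ hα hα3 hα4 hc hα₄ hB hm h33 h69 hu₁ h₁b h₁a h₂b h₂a hmb hma
    hH0 hH1 hsmall hc₃ hs hα₃' hs₁ hs₂ hs₃ hs₄ hs₅ hs₆ hs₇ hX₁ hX₂ hzero₁ hfix₁ hzero₂ hfix₂
  -- the halved smallness in product form: `2C2p(α₃ + 2α₄)B′₀ ≤ ¼`
  have h1 : (40 * d * c + α₄) * (8 * B₀' * (2 * C2p d)) ≤ 1 := by
    have := mul_le_mul_of_nonneg_right hsm8 (by positivity : (0 : ℝ) ≤ 8 * B₀' * (2 * C2p d))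
    rwa [one_div, inv_mul_cancel₀ (by positivity)] at this
  have hq : 2 * C2p d * (40 * d * c + 2 * α₄) * B₀' ≤ 1 / 4 := by
    have e : 2 * C2p d * (40 * d * c + 2 * α₄) * B₀' =
        (40 * d * c + α₄) * (8 * B₀' * (2 * C2p d)) / 4 - 2 * C2p d * B₀' * (40 * ((d : ℝ) * c)) := by ring
    have h0 : 0 ≤ 2 * C2p d * B₀' * (40 * ((d : ℝ) * c)) := by positivity
    rw [e]
    linarith only [h1, h0]
  -- multiply the key inequality by `B′₀` and solve
  set t := ‖X₁ - X₂‖ with ht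
  set a := 2 * C2p d * (40 * d * c + 2 * α₄) with ha
  have hXY : 0 ≤ t := norm_nonneg _
  have ha0 : 0 ≤ a := by rw [ha]; positivity
  have hk : t ≤ a * m + a * B₀' * t := by rw [ha]; linarith only [hkey]
  have hk' : B₀' * t ≤ (a * B₀') * m + (a * B₀') * (B₀' * t) := by
    have := mul_le_mul_of_nonneg_left hk hB.le
    linarith only [this, show B₀' * (a * m + a * B₀' * t) = (a * B₀') * m + (a * B₀') * (B₀' * t) by ring]
  have haB : a * B₀' ≤ 1 / 4 := by rw [ha]; exact hq
  have hBt : 0 ≤ B₀' * t := by positivity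
  have h2 : (a * B₀') * m ≤ 1 / 4 * m := mul_le_mul_of_nonneg_right haB hm
  have h3 : (a * B₀') * (B₀' * t) ≤ 1 / 4 * (B₀' * t) := mul_le_mul_of_nonneg_right haB hBt
  linarith only [hk', h2, h3]

#print axioms Dprime_diff_le_kLevel
#print axioms Dprime_lipschitz_kLevel
#print axioms HDprime_modulus_third_kLevel

end Literature.MathematicalPhysics.QuantumFieldTheory.Balaban1983to89.B8DprimeKLevelLipschitz

end
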